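import Summits.BirchSwinnertonDyer.BirchSwinnertonDyer.Theorems.PrintCf2RubinValueTwoFrameSeedDyadicEmbedding
import Literature.NumberTheory.QuadraticForms.GlobalSquareTheorem
import Literature.NumberTheory.GaloisRepresentations.LocalOneUnitsNumberFieldProofs
import Literature.NumberTheory.GaloisRepresentations.CMTypeHeckeCharacter
import HarnessLib

/-!
# Matching a quadratic Hecke character on the dyadic units: `θK⁻¹η` is unramified at a split `v ∣ 2`
# as soon as `θK` and `η` agree on `⟨±1⟩_v, ⟨±5⟩_v`
# (crux `stmt-BirchSwinnertonDyer-23721` `PrintCf2RubinValueTwo.RubinValueFormulaAtTwo`, line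
# `value-transport`, stub B18s `stub_frameSeed_two` — file 4 of the seed supply)

Cell `bsd-print-cf2`, seat `cruxlead-23721` g3.  Theses-free; `--supports` the crux; no definitions.
At a split dyadic place `v` (`ord_v 2 = 1`, `𝓞 K/𝔭_v³ ≅ ℤ/8` through `φ₀ : 𝓞 K → ℤ₂`, file 1): every local
unit is `a·s²` with a global `a ∈ {1, −1, 5, −5}` — density of `𝓞 K` in `𝒪_v` to depth `𝔭_v³`
(`OneUnits.exists_ringOfIntegers_valued_sub_le`) and `1 + 𝔭_v³ ⊆ (K_vˣ)²` (O'Meara 63:1b, tree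
`QuadraticForms.isSquare_of_valued_sub_one_lt`).  Hence a QUADRATIC `θK` (`θK² = 1`, so `θK` kills squares)
and a character `η` killing the congruence subgroup `1 + 𝔭_v³` whose values on global `v`-units depend
only on the class mod `8` have `θK⁻¹η` unramified at `v` iff they agree on `⟨1⟩, ⟨−1⟩, ⟨5⟩, ⟨−5⟩`
(**`isUnramifiedAt_inv_mul_of_reps`**).  This is the `v`-adic half of the seed supply: `θK|𝒪_vˣ` is one
of the four characters of `(ℤ/8)ˣ`.

HONEST FRAMING: elementary local algebra; closes nothing by itself; beyond-print theorem: no.  BSD is not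
proved by any of this.

References: [Omeara1963] §63A Cor. 63:1b; [NeukirchANT1999] Ch. II §3, §5; [deShalit1987] II.4.17 (54).
-/

-- the summit namespace `Summit.BirchSwinnertonDyer.BirchSwinnertonDyer` repeats the problem name by design (D-0017)
set_option linter.dupNamespace false
set_option autoImplicit false

noncomputable section

open scoped Classical

open NumberField IsDedekindDomain Literature.NumberTheory.GaloisRepresentations
  Literature.NumberTheory.EllipticCurves

namespace Summit.BirchSwinnertonDyer.BirchSwinnertonDyer.Theorems.PrintCf2.FrameSeed

variable {K : Type} [Field K] [NumberField K] {v : HeightOneSpectrum (𝓞 K)}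

/-! ## §1 Squares and quadratic characters on the dyadic one-units -/

/-- `|4|_v = |ϖ_v|²` at an unramified dyadic place (`ord_v 2 = 1`). [folklore] -/
theorem valued_four_eq (h2v : v.intValuation (2 : 𝓞 K) = WithZero.exp (-1 : ℤ)) :
    Valued.v (4 : v.adicCompletion K) = WithZero.exp (-(2 : ℤ)) := by
  have h : (4 : v.adicCompletion K) = algebraMap K (v.adicCompletion K) ((4 : 𝓞 K) : K) := by
    rw [RingOfIntegers.coe_eq_algebraMap, map_ofNat, map_ofNat]
  rw [h, valued_algebraMap_adicCompletion, RingOfIntegers.coe_eq_algebraMap,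
    HeightOneSpectrum.valuation_of_algebraMap, show (4 : 𝓞 K) = 2 * 2 by norm_num, map_mul, h2v,
    ← WithZero.exp_add]
  norm_num

/-- **`1 + 𝔭_v³ ⊆ (K_vˣ)²` at an unramified dyadic place**: a `q ∈ K_v` with `|q − 1|_v ≤ |ϖ_v|³ < |4|_v` is a
square (O'Meara 63:1b). [cite: Omeara1963, §63A Cor. 63:1b] -/
theorem exists_mul_self_eq_of_valued_sub_one_le (h2v : v.intValuation (2 : 𝓞 K) = WithZero.exp (-1 : ℤ))
    (q : (v.adicCompletion K)ˣ) (hq : Valued.v ((q : v.adicCompletion K) - 1) ≤ WithZero.exp (-(3 : ℤ))) :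
    ∃ s : (v.adicCompletion K)ˣ, q = s * s := by
  have hlt : Valued.v ((q : v.adicCompletion K) - 1) < Valued.v (4 : v.adicCompletion K) := by
    rw [valued_four_eq h2v]
    exact hq.trans_lt (WithZero.exp_lt_exp.mpr (by norm_num))
  obtain ⟨s, hs⟩ := Literature.NumberTheory.QuadraticForms.isSquare_of_valued_sub_one_lt K v hlt
  have hs0 : s ≠ 0 := fun h ↦ q.ne_zero (by rw [hs, h, mul_zero])
  exact ⟨Units.mk0 s hs0, Units.ext (by rw [Units.val_mul, Units.val_mk0]; exact hs)⟩

/-- A quadratic Hecke character kills the local squares. [folklore] -/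
theorem apply_localUnits_mul_self {θK : HeckeCharacter K} (hθ : θK * θK = 1) (s : (v.adicCompletion K)ˣ) :
    θK (localUnits v (s * s)) = 1 := by
  have h := congrArg (fun χ : HeckeCharacter K ↦ χ (localUnits v s)) hθ
  simpa only [HeckeCharacter.mul_apply, HeckeCharacter.one_apply, ← map_mul] using h

/-- **A quadratic Hecke character kills `1 + 𝔭_v³`** at an unramified dyadic place. [cite: Omeara1963, §63A Cor. 63:1b] -/
theorem apply_localUnits_eq_one_of_quadratic (h2v : v.intValuation (2 : 𝓞 K) = WithZero.exp (-1 : ℤ))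
    {θK : HeckeCharacter K} (hθ : θK * θK = 1) (q : (v.adicCompletion K)ˣ)
    (hq : Valued.v ((q : v.adicCompletion K) - 1) ≤ WithZero.exp (-(3 : ℤ))) : θK (localUnits v q) = 1 := by
  obtain ⟨s, rfl⟩ := exists_mul_self_eq_of_valued_sub_one_le h2v q hq
  exact apply_localUnits_mul_self hθ s

/-- If `|x − y|_v ≤ |ϖ_v|³` and `|y|_v = 1` then `|x/y − 1|_v ≤ |ϖ_v|³`. [folklore] -/
theorem valued_div_sub_one_le {x y : (v.adicCompletion K)ˣ} (hy : Valued.v (y : v.adicCompletion K) = 1)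
    (h : Valued.v ((x : v.adicCompletion K) - y) ≤ WithZero.exp (-(3 : ℤ))) :
    Valued.v (((x * y⁻¹ : (v.adicCompletion K)ˣ) : v.adicCompletion K) - 1) ≤ WithZero.exp (-(3 : ℤ)) := by
  have hy0 : (y : v.adicCompletion K) ≠ 0 := y.ne_zero
  have heq : ((x * y⁻¹ : (v.adicCompletion K)ˣ) : v.adicCompletion K) - 1 =
      ((x : v.adicCompletion K) - y) * (y : v.adicCompletion K)⁻¹ := by
    rw [Units.val_mul, Units.val_inv_eq_inv_val, sub_mul, mul_inv_cancel₀ hy0]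
  rw [heq, map_mul, map_inv₀, hy, inv_one, mul_one]
  exact h

/-- **Two characters that kill `1 + 𝔭_v³` and agree on a `v`-unit `y` agree on every `x ≡ y`.** [folklore] -/
theorem apply_localUnits_eq_of_congr {χ η : HeckeCharacter K}
    (hχ : ∀ q : (v.adicCompletion K)ˣ, Valued.v ((q : v.adicCompletion K) - 1) ≤ WithZero.exp (-(3 : ℤ)) →
      χ (localUnits v q) = 1)
    (hη : ∀ q : (v.adicCompletion K)ˣ, Valued.v ((q : v.adicCompletion K) - 1) ≤ WithZero.exp (-(3 : ℤ)) →
      η (localUnits v q) = 1)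
    {x y : (v.adicCompletion K)ˣ} (hy : Valued.v (y : v.adicCompletion K) = 1)
    (h : Valued.v ((x : v.adicCompletion K) - y) ≤ WithZero.exp (-(3 : ℤ)))
    (hxy : χ (localUnits v y) = η (localUnits v y)) : χ (localUnits v x) = η (localUnits v x) := by
  have hq := valued_div_sub_one_le hy h
  have hx : x = y * (x * y⁻¹) := by rw [mul_comm x, ← mul_assoc, mul_inv_cancel, one_mul]
  calc χ (localUnits v x) = χ (localUnits v y * localUnits v (x * y⁻¹)) := by rw [← map_mul, ← hx]
    _ = χ (localUnits v y) * χ (localUnits v (x * y⁻¹)) := map_mul _ _ _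
    _ = η (localUnits v y) * η (localUnits v (x * y⁻¹)) := by rw [hxy, hχ _ hq, hη _ hq]
    _ = η (localUnits v x) := by rw [← map_mul, ← map_mul, ← hx]

/-! ## §2 The matching criterion -/

section Matching

/-- The four odd residues: a unit of `ℤ/8` is `1, −1, 5` or `−5`. [folklore] -/
private theorem zmod8_units : ∀ u : (ZMod 8)ˣ,
    (u : ZMod 8) = 1 ∨ (u : ZMod 8) = -1 ∨ (u : ZMod 8) = 5 ∨ (u : ZMod 8) = -5 := by decide

variable {φ₀ : 𝓞 K →+* ℤ_[2]}
  (hv : ∀ k : 𝓞 K, k ∈ v.asIdeal ↔ (2 : ℤ_[2]) ∣ φ₀ k)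
  (h2v : v.intValuation (2 : 𝓞 K) = WithZero.exp (-1 : ℤ))
include hv h2v

/-- A global integer off `𝔭_v` is congruent modulo `𝔭_v³` to one of `1, −1, 5, −5`. [cite: NeukirchANT1999, Ch. II §3] -/
theorem exists_rep_sub_mem_pow_three (a : 𝓞 K) (ha : a ∉ v.asIdeal) :
    ∃ a₀ : 𝓞 K, (a₀ = 1 ∨ a₀ = -1 ∨ a₀ = 5 ∨ a₀ = -5) ∧ a - a₀ ∈ v.asIdeal ^ 3 := by
  obtain ⟨u, hu⟩ := isUnit_toZModPow_of_not_mem hv 3 ha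
  have key : ∀ a₀ : 𝓞 K, PadicInt.toZModPow 3 (φ₀ a) = PadicInt.toZModPow 3 (φ₀ a₀) → a - a₀ ∈ v.asIdeal ^ 3 :=
    fun a₀ h ↦ (toZModPow_eq_iff_sub_mem_pow hv h2v 3 a a₀).mp h
  rcases zmod8_units u with h | h | h | h
  · refine ⟨1, Or.inl rfl, key 1 ?_⟩
    rw [← hu, map_one, map_one]; exact_mod_cast h
  · refine ⟨-1, Or.inr (Or.inl rfl), key (-1) ?_⟩
    rw [← hu, map_neg, map_one, map_neg, map_one]; exact_mod_cast h
  · refine ⟨5, Or.inr (Or.inr (Or.inl rfl)), key 5 ?_⟩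
    rw [← hu, map_ofNat, map_ofNat]; exact_mod_cast h
  · refine ⟨-5, Or.inr (Or.inr (Or.inr rfl)), key (-5) ?_⟩
    rw [← hu, map_neg, map_ofNat, map_neg, map_ofNat]; exact_mod_cast h

omit hv in
/-- The four representatives `1, −1, 5, −5` lie off `𝔭_v` (`2 ∈ 𝔭_v`). [folklore] -/
theorem rep_not_mem {a₀ : 𝓞 K} (h : a₀ = 1 ∨ a₀ = -1 ∨ a₀ = 5 ∨ a₀ = -5) : a₀ ∉ v.asIdeal := by
  have h2 : (2 : 𝓞 K) ∈ v.asIdeal := two_mem_of_intValuation h2v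
  have h1 : (1 : 𝓞 K) ∉ v.asIdeal := fun h ↦ v.isPrime.ne_top ((Ideal.eq_top_iff_one _).mpr h)
  have h5 : (5 : 𝓞 K) ∉ v.asIdeal := fun h5 ↦ h1 (by
    have := v.asIdeal.sub_mem h5 (v.asIdeal.mul_mem_left 2 h2)
    convert this using 1; norm_num)
  rcases h with rfl | rfl | rfl | rfl
  · exact h1
  · exact fun h ↦ h1 (by simpa using v.asIdeal.neg_mem h)
  · exact h5
  · exact fun h ↦ h5 (by simpa using v.asIdeal.neg_mem h)

/-- **THE MATCHING CRITERION AT A SPLIT DYADIC PLACE.**  `K` a number field, `v` a place with `ord_v 2 = 1`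
detected by `φ₀ : 𝓞 K → ℤ₂`; `θK` a Hecke character with `θK² = 1`; `η` a Hecke character killing the
local one-units `1 + 𝔭_v³` whose value on the local idele `⟨a⟩_v` of a global `a ∉ 𝔭_v` is
`c(φ₀ a mod 8)`.  If `θK(⟨a₀⟩_v) = c(φ₀ a₀ mod 8)` for `a₀ ∈ {1, −1, 5, −5}`, then `θK⁻¹η` is UNRAMIFIED at
`v`.  (Every local unit is `≡ a (mod 𝔭_v³)` for a global `a`, `≡ a₀`; `θK` and `η` both kill `1 + 𝔭_v³` —
`θK` because these are squares.) [cite: Omeara1963, §63A Cor. 63:1b] [cite: NeukirchANT1999, Ch. II §3]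
[cite: deShalit1987, II.4.17 (54)] -/
theorem isUnramifiedAt_inv_mul_of_reps {θK η : HeckeCharacter K} (hθ : θK * θK = 1)
    (c : ZMod (2 ^ 3) → ℂ)
    (hηcong : ∀ q : (v.adicCompletion K)ˣ,
      Valued.v ((q : v.adicCompletion K) - 1) ≤ WithZero.exp (-(3 : ℤ)) → η (localUnits v q) = 1)
    (hηval : ∀ a : 𝓞 K, a ∉ v.asIdeal → ∀ ha : algebraMap K (v.adicCompletion K) (a : K) ≠ 0,
      ((η (localUnits v (Units.mk0 _ ha)) : ℂˣ) : ℂ) = c (PadicInt.toZModPow 3 (φ₀ a)))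
    (hreps : ∀ a₀ : 𝓞 K, (a₀ = 1 ∨ a₀ = -1 ∨ a₀ = 5 ∨ a₀ = -5) →
      ∀ ha : algebraMap K (v.adicCompletion K) (a₀ : K) ≠ 0,
      ((θK (localUnits v (Units.mk0 _ ha)) : ℂˣ) : ℂ) = c (PadicInt.toZModPow 3 (φ₀ a₀))) :
    (θK⁻¹ * η).IsUnramifiedAt v := by
  rw [HeckeCharacter.isUnramifiedAt_iff_forall_valued_eq_one]
  intro w hw
  -- it suffices that `θK` and `η` agree on `⟨w⟩_v`
  suffices hagree : θK (localUnits v w) = η (localUnits v w) by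
    rw [HeckeCharacter.mul_apply, HeckeCharacter.inv_apply, hagree, inv_mul_cancel]
  have hθcong : ∀ q : (v.adicCompletion K)ˣ,
      Valued.v ((q : v.adicCompletion K) - 1) ≤ WithZero.exp (-(3 : ℤ)) → θK (localUnits v q) = 1 :=
    fun q hq ↦ apply_localUnits_eq_one_of_quadratic h2v hθ q hq
  -- valuation of global integers
  have hval : ∀ b : 𝓞 K, Valued.v (algebraMap K (v.adicCompletion K) (b : K)) = v.intValuation b := fun b ↦ by
    rw [valued_algebraMap_adicCompletion, RingOfIntegers.coe_eq_algebraMap, HeightOneSpectrum.valuation_of_algebraMap]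
  have hunit : ∀ b : 𝓞 K, b ∉ v.asIdeal → Valued.v (algebraMap K (v.adicCompletion K) (b : K)) = 1 := fun b hb ↦ by
    rw [hval, HeightOneSpectrum.intValuation_eq_one_iff.mpr hb]
  have hne0 : ∀ b : 𝓞 K, b ∉ v.asIdeal → algebraMap K (v.adicCompletion K) (b : K) ≠ 0 := fun b hb h0 ↦ by
    have := hunit b hb; rw [h0, map_zero] at this; exact zero_ne_one this
  -- step 1: `w ≡ a (mod 𝔭_v³)` for a global `a ∉ 𝔭_v`
  obtain ⟨a, ha⟩ := OneUnits.exists_ringOfIntegers_valued_sub_le K v ⟨(w : v.adicCompletion K), hw.le⟩ 3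
  have haK : ((algebraMap (𝓞 K) (v.adicCompletionIntegers K) a : v.adicCompletionIntegers K) : v.adicCompletion K) =
      algebraMap K (v.adicCompletion K) (a : K) := rfl
  rw [haK] at ha
  change Valued.v ((w : v.adicCompletion K) - algebraMap K (v.adicCompletion K) (a : K)) ≤ WithZero.exp (-(3 : ℤ)) at ha
  have hlt1 : Valued.v ((w : v.adicCompletion K) - algebraMap K (v.adicCompletion K) (a : K)) < 1 :=
    ha.trans_lt (by rw [← WithZero.exp_zero, WithZero.exp_lt_exp]; norm_num)
  have hA1 : Valued.v (algebraMap K (v.adicCompletion K) (a : K)) = 1 := by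
    have h := Valuation.map_eq_of_sub_lt Valued.v (x := (w : v.adicCompletion K))
      (y := algebraMap K (v.adicCompletion K) (a : K)) (by rw [Valuation.map_sub_swap, hw]; exact hlt1)
    rw [h, hw]
  have hav : a ∉ v.asIdeal := by
    rw [← HeightOneSpectrum.intValuation_eq_one_iff, ← hval]; exact hA1
  -- step 2: reduce `a` to a representative `a₀`
  obtain ⟨a₀, ha₀, hsub⟩ := exists_rep_sub_mem_pow_three hv h2v a hav
  have ha₀v : a₀ ∉ v.asIdeal := rep_not_mem h2v ha₀
  set A : (v.adicCompletion K)ˣ := Units.mk0 _ (hne0 a hav) with hA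
  set A₀ : (v.adicCompletion K)ˣ := Units.mk0 _ (hne0 a₀ ha₀v) with hA₀
  have hAA₀ : Valued.v ((A : v.adicCompletion K) - A₀) ≤ WithZero.exp (-(3 : ℤ)) := by
    rw [hA, hA₀, Units.val_mk0, Units.val_mk0, ← map_sub]
    have : ((a : K) - (a₀ : K)) = ((a - a₀ : 𝓞 K) : K) := by push_cast; ring
    rw [this, hval]
    exact (v.intValuation_le_pow_iff_mem (a - a₀) 3).mpr hsub
  -- step 3: agreement on `A₀`, then on `A`, then on `w`
  have hagree₀ : θK (localUnits v A₀) = η (localUnits v A₀) :=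
    Units.ext (by rw [hA₀, hreps a₀ ha₀ (hne0 a₀ ha₀v), hηval a₀ ha₀v (hne0 a₀ ha₀v)])
  have hagreeA : θK (localUnits v A) = η (localUnits v A) :=
    apply_localUnits_eq_of_congr hθcong hηcong (by rw [hA₀, Units.val_mk0]; exact hunit a₀ ha₀v) hAA₀ hagree₀
  exact apply_localUnits_eq_of_congr hθcong hηcong (by rw [hA, Units.val_mk0]; exact hA1)
    (by rw [hA, Units.val_mk0]; exact ha) hagreeA

end Matching

end Summit.BirchSwinnertonDyer.BirchSwinnertonDyer.Theorems.PrintCf2.FrameSeed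

end
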